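/-
Copyright (c) 2026 the pub-hodgecm-mathlib formalisation cell (harness21).  Prover seat hodgecm-mathlib-LH4-p10 (g9) (valve hand), Track B «K2-LIT»,
#184♮ = hLiu418 = `stmt-HodgeConjecture-24832`; socket #41, KIND W, organ «Φ6b-ind» (R3)-G6 OF RECORD: the G6 head with its ONE letter `hJetGrowth` DISCHARGED BY NAME
(★ G5 `K2LiuHermTwoXiJetContinuationGrowth.hJet_holds_growth` ∘ ★ G4 `K2LiuHermTwoXiMomentDecay.traceMoment_decay'`).  THEOREMS ONLY.
-/
import Summits.HodgeConjecture.HodgeConjecture.Theorems.K2LiuKindWArchWhittakerGrowthIndef        -- ★ p864400 (this seat): the G6 head, hypothesis-first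
import Summits.HodgeConjecture.HodgeConjecture.Theorems.K2LiuHermTwoXiJetContinuationGrowth     -- ★ p864295 (K2E4-p10): (R3)-G5 `hJet_holds_growth`
import Summits.HodgeConjecture.HodgeConjecture.Theorems.K2LiuHermTwoXiMomentDecay               -- ★ p864342∕p864357 (K2E4-p11): (R3)-G4 `traceMoment_decay'`
import HarnessLib

/-!
# Crux `HLiu418`, socket #41, KIND W — (R3)-G6 OF RECORD `K2LiuKindWArchWhittakerGrowthIndefOfRecord`: the indefinite growth face, UNCONDITIONAL

Cell `hodgecm-mathlib`, crux item hLiu418 = `stmt-HodgeConjecture-24832` (helper lane `--supports … --as helper`, count-neutral).  ★ p864400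
`exists_growth_constants_of_indef_pic` takes the jet-growth letter `hJetGrowth` BY VALUE; the organ's (R3)-G5 ★ `hJet_holds_growth Θ hΘ hG4 e a b` and (R3)-G4 ★
`traceMoment_decay' Θ` pay it BY NAME (`Θ.IsHermitian` is `Θᴴ = Θ` by definition).  THIS FILE is the two one-liners with the letter gone:
**`exists_growth_constants_of_indef_pic_of_record (hk) (Pic) (hx) (hKpic)`** and **`exists_growth_constants_of_indef_at_one_of_record (hk) (Q) (hx) (hKpic)`** — ★ p864400's
conclusions VERBATIM, no analytic hypothesis left: the «Φ6b-ind» growth face in the `hAtOne` alphabet of (3d-iv) (K2E3-p11) ∕ (3c) (K2Liu-p11), by name.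
[Shimura1982, §3 Thm. 3.1, §4 Thm. 4.2] [Shimura1997, §16.4, §18.4] [KudlaRallis1994, §1].
HONEST LABEL.  Count-neutral helper; with ★ G1∕G2∕G4∕G5∕G6 the organ «Φ6b-ind» is ★ by name, but it closes no socket by itself: `HC_CM` is proved only modulo the 7 printed
citations (2 remaining named inputs: hLiu418 = `stmt-HodgeConjecture-24832`, h413 = `stmt-HodgeConjecture-24833`) until rung 0 closes.
-/

set_option autoImplicit false
set_option linter.dupNamespace false -- the mandated namespace repeats `HodgeConjecture.HodgeConjecture`

noncomputable section

open Complex Matrix MeasureTheory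
open scoped ComplexConjugate ComplexOrder
open Literature.NumberTheory.ModularForms.SiegelUpperHalfSpace (moeb)

namespace Summit.HodgeConjecture.HodgeConjecture.Cruxes.HLiu418.K2LiuKindWArchWhittakerGrowthIndefOfRecord

open Summit.HodgeConjecture.HodgeConjecture.Cruxes.HLiu418.K2LiuArchInducedTubeDefs
open Summit.HodgeConjecture.HodgeConjecture.Cruxes.HLiu418.K2LiuU22CompactPictureDefs
open Summit.HodgeConjecture.HodgeConjecture.Cruxes.HLiu418.K2LiuKindWArchWhittakerGrowthIndef (exists_growth_constants_of_indef_pic)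
open Summit.HodgeConjecture.HodgeConjecture.Cruxes.HLiu418.K2LiuHermTwoXiJetContinuationGrowth (hJet_holds_growth)
open Summit.HodgeConjecture.HodgeConjecture.Cruxes.HLiu418.K2LiuHermTwoXiMomentDecay (traceMoment_decay')

/-- **(R3)-G6 OF RECORD, GENERIC PICTURE** — ★ `exists_growth_constants_of_indef_pic` with `hJetGrowth := fun Θ hΘ e a b => hJet_holds_growth Θ hΘ (traceMoment_decay' Θ) e a b`
(★ G5 ∘ ★ G4): the indefinite growth face with NO analytic hypothesis. [cite: Shimura1982, §4 Thm. 4.2] [cite: Shimura1997, §16.4, §18.4] [cite: KudlaRallis1994, §1] -/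
theorem exists_growth_constants_of_indef_pic_of_record
    {k : ℤ} (hk : -2 ≤ k) (Pic : ℂ → (Matrix (Fin 2 ⊕ Fin 2) (Fin 2 ⊕ Fin 2) ℂ → ℂ) → Prop) {B C : Matrix (Fin 2) (Fin 2) ℂ}
    (hx : (fromBlocks 0 B C 0 : Matrix (Fin 2 ⊕ Fin 2) (Fin 2 ⊕ Fin 2) ℂ)ᴴ * Matrix.J (Fin 2) ℂ * (fromBlocks 0 B C 0 : Matrix (Fin 2 ⊕ Fin 2) (Fin 2 ⊕ Fin 2) ℂ) =
      Matrix.J (Fin 2) ℂ)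
    (hKpic : ∀ k₀ : Matrix (Fin 2 ⊕ Fin 2) (Fin 2 ⊕ Fin 2) ℂ, k₀ᴴ * Matrix.J (Fin 2) ℂ * k₀ = Matrix.J (Fin 2) ℂ →
      moeb k₀ (I • (1 : Matrix (Fin 2) (Fin 2) ℂ)) = I • 1 →
      ∃ P : MvPolynomial (((Fin 2 ⊕ Fin 2) × (Fin 2 ⊕ Fin 2)) ⊕ ((Fin 2 ⊕ Fin 2) × (Fin 2 ⊕ Fin 2))) ℂ,
        ∀ (s : ℂ) (F : Matrix (Fin 2 ⊕ Fin 2) (Fin 2 ⊕ Fin 2) ℂ → ℂ), IsArchSiegelSection (fun z : ℂ => (conj z / ((‖z‖ : ℝ) : ℂ)) ^ k) s F →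
          Pic s F →
          ∀ u : Matrix (Fin 2 ⊕ Fin 2) (Fin 2 ⊕ Fin 2) ℂ, uᴴ * Matrix.J (Fin 2) ℂ * u = Matrix.J (Fin 2) ℂ → moeb u (I • (1 : Matrix (Fin 2) (Fin 2) ℂ)) = I • 1 →
            F (u * k₀) = MvPolynomial.eval (Sum.elim (fun pq => u pq.1 pq.2) (fun pq => conj (u pq.1 pq.2))) P) :
    ∃ Ew : Matrix (Fin 2) (Fin 2) ℂ → Matrix (Fin 2 ⊕ Fin 2) (Fin 2 ⊕ Fin 2) ℂ → ℂ → ℂ,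
      (∀ hidx : Matrix (Fin 2) (Fin 2) ℂ, hidxᴴ = hidx ∧ hidx.det.re < 0 →
        ∀ eb : Matrix (Fin 2) (Fin 2) ℂ → ℂ, (∀ b, eb b = cexp (-(2 * Real.pi * I) * (hidx * b).trace)) →
        ∀ g : Matrix (Fin 2 ⊕ Fin 2) (Fin 2 ⊕ Fin 2) ℂ, gᴴ * Matrix.J (Fin 2) ℂ * g = Matrix.J (Fin 2) ℂ →
        DifferentiableOn ℂ (Ew hidx g) {s : ℂ | 0 < s.re} ∧
        ∃ s₀ : ℝ, ∀ s : ℂ, s₀ < s.re →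
          ∀ F : Matrix (Fin 2 ⊕ Fin 2) (Fin 2 ⊕ Fin 2) ℂ → ℂ, IsArchSiegelSection (fun z : ℂ => (conj z / ((‖z‖ : ℝ) : ℂ)) ^ k) s F →
            Pic s F →
            ∫ r : Fin 2 → Fin 2 → ℝ, F ((fromBlocks 0 B C 0 : Matrix (Fin 2 ⊕ Fin 2) (Fin 2 ⊕ Fin 2) ℂ) * fromBlocks 1 (hermOfReal r) 0 1 * g) * eb (hermOfReal r) =
              Ew hidx g s) ∧
      ∀ z : ℂ, 0 < z.re → ∃ Cg cg N N' r : ℝ, 0 ≤ Cg ∧ 0 < cg ∧ 0 ≤ N ∧ 0 ≤ N' ∧ 0 < r ∧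
        ∀ hidx : Matrix (Fin 2) (Fin 2) ℂ, hidxᴴ = hidx ∧ hidx.det.re < 0 →
        ∀ eb : Matrix (Fin 2) (Fin 2) ℂ → ℂ, (∀ b, eb b = cexp (-(2 * Real.pi * I) * (hidx * b).trace)) →
        ∀ g : Matrix (Fin 2 ⊕ Fin 2) (Fin 2 ⊕ Fin 2) ℂ, gᴴ * Matrix.J (Fin 2) ℂ * g = Matrix.J (Fin 2) ℂ →
          ∀ (X₀ R : Matrix (Fin 2) (Fin 2) ℂ), X₀ᴴ = X₀ → Rᴴ = R → IsUnit R.det →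
            (fromBlocks C 0 0 (-B) : Matrix (Fin 2 ⊕ Fin 2) (Fin 2 ⊕ Fin 2) ℂ) * g = fromBlocks 1 X₀ 0 1 * fromBlocks R 0 0 R⁻¹ →
            ∀ s : ℂ, dist s z < r →
              ‖Ew hidx g s‖ ≤ Cg * ‖R.det‖ ^ (2 - 2 * s.re) * Real.exp (-(cg * ∑ a, ∑ b, ‖(R * ((C⁻¹)ᴴ * hidx * C⁻¹) * R) a b‖)) *
                (1 + ∑ a, ∑ b, ‖(R * ((C⁻¹)ᴴ * hidx * C⁻¹) * R) a b‖) ^ N * (1 + ‖(R * ((C⁻¹)ᴴ * hidx * C⁻¹) * R).det‖ ^ (-N')) :=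
  exists_growth_constants_of_indef_pic (fun Θ hΘ e a b => hJet_holds_growth Θ hΘ (traceMoment_decay' Θ) e a b) hk Pic hx hKpic

end Summit.HodgeConjecture.HodgeConjecture.Cruxes.HLiu418.K2LiuKindWArchWhittakerGrowthIndefOfRecord

end
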